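import Mathlib.MeasureTheory.MeasurableSpace.CountablyGenerated
import Mathlib.MeasureTheory.Integral.Prod
import Mathlib.MeasureTheory.Constructions.Pi
import HarnessLib

/-!
# Reduction to a countably generated sub-σ-algebra; product integrals under trimming — PROVED

Topic `Literature/MeasureTheory/Integral`; generic measure theory (written for crux `FibreAnchor`, route
`QuantumFields/ContractibleFibre`, stub `stub_traceFormulaClustering`, whose spectral argument needs a COUNTABLE Hilbert basis
of `L²`, i.e. a countably generated σ-algebra, while the statement is over an arbitrary measurable space; Mathlib only, no
definitions).  Finitely many real-valued measurable functions on finite products of `X` (and one kernel on `X × X`) are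
already measurable for the products of ONE countably generated sub-σ-algebra `m₀ ≤ m` (`exists_countablyGenerated_data`:
induction over the generation of the product σ-algebra by cylinders, countable suprema of countably generated σ-algebras),
and finite-product / iterated integrals of such functions are unchanged when `μ` is replaced by its restriction `μ.trim` to
`m₀` (`integral_pi_trim_eq`, `integral_integral_trim_eq`: uniqueness of product measures on boxes + `integral_trim`).
[folklore]
-/

set_option autoImplicit false

noncomputable section

namespace Literature.MeasureTheory.Integral

open _root_.MeasureTheory Set

/-! ### Countably generated sub-σ-algebras carrying finitely many measurable functions -/

/-- Monotonicity of the product σ-algebra in the factor σ-algebra. [folklore] -/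
theorem measurableSpace_pi_mono {X ι : Type*} {m m' : MeasurableSpace X} (h : m ≤ m') :
    (@MeasurableSpace.pi ι (fun _ => X) fun _ => m) ≤ @MeasurableSpace.pi ι (fun _ => X) fun _ => m' :=
  iSup_mono fun _ => MeasurableSpace.comap_mono h

/-- Monotonicity of the binary product σ-algebra. [folklore] -/
theorem measurableSpace_prod_mono {X : Type*} {m m' : MeasurableSpace X} (h : m ≤ m') : m.prod m ≤ m'.prod m' :=
  sup_le_sup (MeasurableSpace.comap_mono h) (MeasurableSpace.comap_mono h)

/-- A countable supremum of countably generated σ-algebras is countably generated. [folklore] -/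
theorem countablyGenerated_iSup {X κ : Type*} [Countable κ] {m : κ → MeasurableSpace X}
    (h : ∀ k, @MeasurableSpace.CountablyGenerated X (m k)) : @MeasurableSpace.CountablyGenerated X (⨆ k, m k) := by
  choose b hbc hbe using fun k => (h k).isCountablyGenerated
  refine @MeasurableSpace.CountablyGenerated.mk _ (⨆ k, m k) ⟨⋃ k, b k, countable_iUnion hbc, ?_⟩
  rw [← MeasurableSpace.iSup_generateFrom]
  exact iSup_congr hbe

/-- The trivial σ-algebra is countably generated. [folklore] -/
theorem countablyGenerated_bot {X : Type*} : @MeasurableSpace.CountablyGenerated X ⊥ :=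
  @MeasurableSpace.CountablyGenerated.mk _ ⊥ ⟨∅, countable_empty, MeasurableSpace.generateFrom_empty.symm⟩

/-- A single measurable set of a product σ-algebra is measurable for the product of a countably generated
sub-σ-algebra of the factor (induction over the generation by cylinders). [folklore] -/
theorem exists_countablyGenerated_of_measurableSet_pi {X ι : Type*} (m : MeasurableSpace X) {S : Set (ι → X)}
    (hS : MeasurableSet[@MeasurableSpace.pi ι (fun _ => X) fun _ => m] S) :
    ∃ m₀ : MeasurableSpace X, m₀ ≤ m ∧ @MeasurableSpace.CountablyGenerated X m₀ ∧
      MeasurableSet[@MeasurableSpace.pi ι (fun _ => X) fun _ => m₀] S := by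
  rw [MeasurableSpace.pi_eq_generateFrom_projections (mα := fun _ => m)] at hS
  refine MeasurableSpace.generateFrom_induction _
    (fun S _ => ∃ m₀ : MeasurableSpace X, m₀ ≤ m ∧ @MeasurableSpace.CountablyGenerated X m₀ ∧
      MeasurableSet[@MeasurableSpace.pi ι (fun _ => X) fun _ => m₀] S) ?_ ?_ ?_ ?_ S hS
  · rintro _ ⟨i, A, hA, rfl⟩ -
    refine ⟨MeasurableSpace.generateFrom {A}, MeasurableSpace.generateFrom_le (by simpa using hA),
      @MeasurableSpace.CountablyGenerated.mk _ (MeasurableSpace.generateFrom {A}) ⟨{A}, countable_singleton A, rfl⟩,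
      ?_⟩
    exact @measurable_pi_apply ι (fun _ => X) (fun _ => MeasurableSpace.generateFrom {A}) i _
      (MeasurableSpace.measurableSet_generateFrom (mem_singleton A))
  · exact ⟨⊥, bot_le, countablyGenerated_bot, @MeasurableSet.empty _ (@MeasurableSpace.pi ι (fun _ => X) fun _ => ⊥)⟩
  · rintro T - ⟨m₀, hle, hcg, hT⟩
    exact ⟨m₀, hle, hcg, hT.compl⟩
  · intro f _ hf
    choose m₀ hle hcg hf' using hf
    refine ⟨⨆ k, m₀ k, iSup_le hle, countablyGenerated_iSup hcg, MeasurableSet.iUnion fun k => ?_⟩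
    exact measurableSpace_pi_mono (le_iSup m₀ k) _ (hf' k)

/-- **A real-valued function measurable for a product σ-algebra is measurable for the product of a countably
generated sub-σ-algebra of the factor.** [folklore] -/
theorem exists_countablyGenerated_of_measurable_pi {X ι : Type*} (m : MeasurableSpace X) {f : (ι → X) → ℝ}
    (hf : Measurable[@MeasurableSpace.pi ι (fun _ => X) fun _ => m] f) :
    ∃ m₀ : MeasurableSpace X, m₀ ≤ m ∧ @MeasurableSpace.CountablyGenerated X m₀ ∧
      Measurable[@MeasurableSpace.pi ι (fun _ => X) fun _ => m₀] f := by
  have hGc : (MeasurableSpace.countableGeneratingSet ℝ).Countable := MeasurableSpace.countable_countableGeneratingSet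
  haveI : Countable (MeasurableSpace.countableGeneratingSet ℝ) := hGc.to_subtype
  have hpre : ∀ t : MeasurableSpace.countableGeneratingSet ℝ, ∃ m₀ : MeasurableSpace X, m₀ ≤ m ∧
      @MeasurableSpace.CountablyGenerated X m₀ ∧
      MeasurableSet[@MeasurableSpace.pi ι (fun _ => X) fun _ => m₀] (f ⁻¹' (t : Set ℝ)) := fun t =>
    exists_countablyGenerated_of_measurableSet_pi m (hf (MeasurableSpace.measurableSet_countableGeneratingSet t.2))
  choose m₀ hle hcg hm₀ using hpre
  refine ⟨⨆ t, m₀ t, iSup_le hle, countablyGenerated_iSup hcg, ?_⟩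
  have h : @Measurable (ι → X) ℝ (@MeasurableSpace.pi ι (fun _ => X) fun _ => ⨆ t, m₀ t)
      (MeasurableSpace.generateFrom (MeasurableSpace.countableGeneratingSet ℝ)) f :=
    @measurable_generateFrom (ι → X) ℝ (@MeasurableSpace.pi ι (fun _ => X) fun _ => ⨆ t, m₀ t)
      (MeasurableSpace.countableGeneratingSet ℝ) f fun t ht => measurableSpace_pi_mono (le_iSup m₀ ⟨t, ht⟩) _ (hm₀ ⟨t, ht⟩)
  rwa [MeasurableSpace.generateFrom_countableGeneratingSet (α := ℝ)] at h

/-- The binary-product version of `exists_countablyGenerated_of_measurable_pi` (via `Bool → X`). [folklore] -/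
theorem exists_countablyGenerated_of_measurable_prod {X : Type*} (m : MeasurableSpace X) {K : X → X → ℝ}
    (hK : Measurable[m.prod m] (Function.uncurry K)) :
    ∃ m₀ : MeasurableSpace X, m₀ ≤ m ∧ @MeasurableSpace.CountablyGenerated X m₀ ∧
      Measurable[m₀.prod m₀] (Function.uncurry K) := by
  have hK'm : Measurable[@MeasurableSpace.pi Bool (fun _ => X) fun _ => m] (fun v : Bool → X => K (v true) (v false)) :=
    hK.comp (f := fun v : Bool → X => (v true, v false))
      ((@measurable_pi_apply Bool (fun _ => X) (fun _ => m) true).prodMk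
        (@measurable_pi_apply Bool (fun _ => X) (fun _ => m) false))
  obtain ⟨m₀, hle, hcg, hm₀⟩ := exists_countablyGenerated_of_measurable_pi m hK'm
  refine ⟨m₀, hle, hcg, ?_⟩
  have he : @Measurable (X × X) (Bool → X) (m₀.prod m₀) (@MeasurableSpace.pi Bool (fun _ => X) fun _ => m₀)
      (fun p : X × X => fun b : Bool => cond b p.1 p.2) := by
    refine @measurable_pi_lambda (X × X) Bool (fun _ => X) (m₀.prod m₀) (fun _ => m₀) _ fun b => ?_
    cases b
    · exact @measurable_snd X X m₀ m₀
    · exact @measurable_fst X X m₀ m₀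
  exact hm₀.comp he

/-- **The countably generated reduction**: a kernel `K` on `X × X` and two functions `F₁`, `F₂` of a product
`ι → X`, all measurable, are measurable for the corresponding products of ONE countably generated sub-σ-algebra
`m₀ ≤ m`. [folklore] -/
theorem exists_countablyGenerated_data {X : Type*} [m : MeasurableSpace X] {ι : Type*} {K : X → X → ℝ}
    (hK : Measurable (Function.uncurry K)) {F₁ F₂ : (ι → X) → ℝ} (hF₁ : Measurable F₁) (hF₂ : Measurable F₂) :
    ∃ m₀ : MeasurableSpace X, m₀ ≤ m ∧ @MeasurableSpace.CountablyGenerated X m₀ ∧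
      Measurable[m₀.prod m₀] (Function.uncurry K) ∧
      Measurable[@MeasurableSpace.pi ι (fun _ => X) fun _ => m₀] F₁ ∧
      Measurable[@MeasurableSpace.pi ι (fun _ => X) fun _ => m₀] F₂ := by
  obtain ⟨m₁, h₁, hc₁, hK₁⟩ := exists_countablyGenerated_of_measurable_prod m hK
  obtain ⟨m₂, h₂, hc₂, hF₁'⟩ := exists_countablyGenerated_of_measurable_pi m hF₁
  obtain ⟨m₃, h₃, hc₃, hF₂'⟩ := exists_countablyGenerated_of_measurable_pi m hF₂
  refine ⟨m₁ ⊔ (m₂ ⊔ m₃), sup_le h₁ (sup_le h₂ h₃), hc₁.sup (hc₂.sup hc₃), ?_, ?_, ?_⟩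
  · exact hK₁.mono (measurableSpace_prod_mono le_sup_left) le_rfl
  · exact hF₁'.mono (measurableSpace_pi_mono (le_sup_left.trans le_sup_right)) le_rfl
  · exact hF₂'.mono (measurableSpace_pi_mono (le_sup_right.trans le_sup_right)) le_rfl

/-! ### Integrals are unchanged under trimming

In the following three lemmas the SMALL σ-algebra `m₀` is declared last, so that it is the one found by instance
resolution, and the terms living on the ambient σ-algebra `m ≥ m₀` are spelled out. -/

/-- The restriction of a probability measure to a sub-σ-algebra is a probability measure. [folklore] -/
theorem isProbabilityMeasure_trim' {X : Type*} {m : MeasurableSpace X} [m₀ : MeasurableSpace X] (hle : m₀ ≤ m)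
    (μ : @Measure X m) [IsProbabilityMeasure μ] : IsProbabilityMeasure (μ.trim hle) :=
  ⟨by rw [trim_measurableSet_eq hle MeasurableSet.univ, measure_univ]⟩

/-- **Finite product integrals are unchanged under trimming**: for `f` measurable for the product of the
sub-σ-algebra `m₀ ≤ m`, `∫ f d(μ.trim)^{⊗ι} = ∫ f dμ^{⊗ι}` (the product of the trimmed measures is the trimmed product
measure, by uniqueness on boxes). [folklore] -/
theorem integral_pi_trim_eq {X : Type*} {m : MeasurableSpace X} [m₀ : MeasurableSpace X] (hle : m₀ ≤ m)
    (μ : @Measure X m) [IsProbabilityMeasure μ] {ι : Type*} [Fintype ι] {f : (ι → X) → ℝ} (hf : Measurable f) :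
    ∫ V, f V ∂(Measure.pi fun _ => μ.trim hle) = ∫ V, f V ∂(@Measure.pi ι (fun _ => X) _ (fun _ => m) fun _ => μ) := by
  haveI : IsProbabilityMeasure (μ.trim hle) := isProbabilityMeasure_trim' hle μ
  have hpile : (MeasurableSpace.pi : MeasurableSpace (ι → X)) ≤ @MeasurableSpace.pi ι (fun _ => X) fun _ => m :=
    measurableSpace_pi_mono hle
  have hpi : (Measure.pi fun _ => μ.trim hle) = (@Measure.pi ι (fun _ => X) _ (fun _ => m) fun _ => μ).trim hpile := by
    refine Measure.pi_eq fun s hs => ?_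
    rw [trim_measurableSet_eq hpile (MeasurableSet.univ_pi hs),
      @Measure.pi_pi ι (fun _ => X) _ (fun _ => m) (fun _ => μ) (fun _ => IsFiniteMeasure.toSigmaFinite μ) s]
    exact Finset.prod_congr rfl fun i _ => (trim_measurableSet_eq hle (hs i)).symm
  rw [hpi, ← integral_trim hpile hf.stronglyMeasurable]

/-- **Iterated integrals are unchanged under trimming**, for a jointly `m₀ ⊗ m₀`-measurable integrand. [folklore] -/
theorem integral_integral_trim_eq {X : Type*} {m : MeasurableSpace X} [m₀ : MeasurableSpace X] (hle : m₀ ≤ m)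
    (μ : @Measure X m) [IsProbabilityMeasure μ] {g : X → X → ℝ} (hg : Measurable (Function.uncurry g)) :
    ∫ x, ∫ y, g x y ∂(μ.trim hle) ∂(μ.trim hle) = ∫ x, ∫ y, g x y ∂μ ∂μ := by
  haveI : IsProbabilityMeasure (μ.trim hle) := isProbabilityMeasure_trim' hle μ
  have hinner : ∀ x, ∫ y, g x y ∂(μ.trim hle) = ∫ y, g x y ∂μ := fun x =>
    (integral_trim hle hg.of_uncurry_left.stronglyMeasurable).symm
  have hsm : StronglyMeasurable fun x => ∫ y, g x y ∂(μ.trim hle) :=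
    hg.stronglyMeasurable.integral_prod_right' (ν := μ.trim hle)
  rw [← integral_trim hle hsm]
  exact integral_congr_ae (Filter.Eventually.of_forall hinner)

end Literature.MeasureTheory.Integral

end
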